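import Mathlib
import HarnessLib
import Literature.Analysis.FluidPDE.TypeIAncientMild
import Literature.Analysis.FluidPDE.TypeIAncientMildRssPullback
import Summits.NavierStokesRegularity.NavierStokesRegularity.Theses.ExtremalTypeIConstant
import Summits.NavierStokesRegularity.NavierStokesRegularity.Theorems.SymmetryModuliCountForcedSymmetryBlowDownResidual

/-!
# Crux `ExtremalTypeIConstant.ExtremalSpiralSymmetry` (stmt-NavierStokesRegularity-8215), line `registered`:
# stub `stub_scalingRecurrence` is NECESSARY: the crux integrates to an exact scaling period (lead c2 / worker audit)

The registered stub `stub_scalingRecurrence` (recurrence half of the route's Conjecture M: an EXTREMAL pair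
`(C, u)` of the KNSS-gauge Type-I ancient mild class has one nontrivial scaling period `c ≠ 1` modulo a rigid
motion `g_{b,R}` and a forward time shift `θ_δ`, `δ ≥ 0`) is open and has no in-tree named source. This
support file (`--supports stmt-NavierStokesRegularity-8215`, registered sub-goal `stub_scalingRecurrence_of_ExtremalSpiralSymmetry`; theorems only) records, Lean-checked, the two kinds of EXISTING named statements that imply it NOW:

* `stub_scalingRecurrence_of_ExtremalSpiralSymmetry` — **the crux itself implies the stub, non-vacuously**:
  the crux's infinitesimal spiral-scaling symmetry `∇u·(a + x + Ax) + u + 2t∂ₜu − Au = 0` (`A` skew)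
  integrates (rotated Euler homogeneity `Literature.Analysis.FluidPDE.rss_pull_const`, centre `x_c` with
  `x_c + A x_c = −a`, which exists because `1 + A` is injective on `ℝ³`) to the exact period
  `e • u (e² t, e • x) = R (u t (R⁻¹ (x − b)))` with `R = e^{A}` (a linear isometry, `rss_exists_rot`),
  `b = e⁻¹ x_c − R x_c`, `δ = 0`. So the stub is a NECESSARY intermediate of the skeleton: together with the
  skeleton's `ExtremalSpiralSymmetry_of` (stub 1 ∧ stub 2 ⇒ crux) and the same integration for every factor
  (crux ⇒ stub 2), the line's cut `crux ⇔ stub_scalingRecurrence ∧ stub_continuousOfDiscrete` has no slack.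
* `stub_scalingRecurrence_of_TypeIAncientLiouville`, `stub_scalingRecurrence_of_ForcedSymmetry` — the
  route target `X = TypeIAncientLiouville` (stmt-4050) and everything proved equivalent to it in tree
  (`ForcedSymmetry` stmt-4052 via `forcedSymmetry_iff_typeIAncientLiouville`; likewise `RecurrentLiouville`
  stmt-1589, `NoTypeIRateProfile` stmt-1588, `SqueezeLiouville`, `ExtremalBiaxialitySubcritical`, …) imply
  the stub VACUOUSLY: under `X` no extremal pair with `C > 0` exists (`‖u(−1,0)‖ = C > 0` contradicts `u ≡ 0`).

No named statement strictly between these exists in the tree: nothing asserts that a GIVEN element of `A_C`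
(extremal, singular or recurrent) is RDSS, except `DulacContraction.SynchronizationForcesSelfSimilarity`
(stmt-8560), whose hypotheses (K1 = stmt-8559, Albritton–Barker slab class, origin-singular AND Birkhoff
recurrent profile) are not available for an extremal of `A_C`.
-/

noncomputable section

set_option linter.dupNamespace false

namespace Summit.NavierStokesRegularity.NavierStokesRegularity.Theorems.ExtremalSpiralSymmetry.Registered

open Literature.Analysis.FluidPDE Set Function
open scoped RealInnerProductSpace

/-- For a skew operator `A` on `ℝ³` (`⟪Ax, x⟫ = 0`) and any `a` there is a centre `x_c` with
`x_c + A x_c = −a`: `1 + A` is injective (`⟪(1 + A)x, x⟫ = ‖x‖²`), hence onto (finite dimension). [folklore] -/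
theorem exists_centre_of_skew (A : (EuclideanSpace ℝ (Fin 3)) →L[ℝ] (EuclideanSpace ℝ (Fin 3))) (hA : ∀ x, inner ℝ (A x) x = 0) (a : (EuclideanSpace ℝ (Fin 3))) :
    ∃ xc : (EuclideanSpace ℝ (Fin 3)), xc + A xc = -a := by
  set T : (EuclideanSpace ℝ (Fin 3)) →L[ℝ] (EuclideanSpace ℝ (Fin 3)) := 1 + A with hT
  have hTx : ∀ x, T x = x + A x := fun x => rfl
  have hinj : Function.Injective (T : (EuclideanSpace ℝ (Fin 3)) →ₗ[ℝ] (EuclideanSpace ℝ (Fin 3))) := by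
    intro x y hxy
    have hxy' : T x = T y := hxy
    rw [← sub_eq_zero]
    have h0 : T (x - y) = 0 := by rw [map_sub, hxy', sub_self]
    have h1 : inner ℝ (T (x - y)) (x - y) = (0 : ℝ) := by rw [h0, inner_zero_left]
    rw [hTx, inner_add_left, hA, add_zero, real_inner_self_eq_norm_sq] at h1
    exact norm_eq_zero.1 ((pow_eq_zero_iff two_ne_zero).1 h1)
  obtain ⟨xc, hxc⟩ := LinearMap.surjective_of_injective hinj (-a)
  exact ⟨xc, by simpa [hTx] using hxc⟩

/-- **The crux implies the stub (non-vacuously).** `ExtremalSpiralSymmetry` gives an extremal pair an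
infinitesimal spiral-scaling symmetry with skew rotation part `A`; with the centre `x_c`, `x_c + A x_c = −a`,
the generator is the normalised rotated scaling generator with vertex `(0, x_c)` and `B = A`, and rotated
Euler homogeneity (`rss_pull_const`, parameters `0` and `1`) yields the exact scaling period with factor
`e = exp 1 ≠ 1`, rotation `R = e^{A}`, translation `b = e⁻¹x_c − Rx_c` and NO time shift. [folklore] -/
theorem stub_scalingRecurrence_of_ExtremalSpiralSymmetry :
    _root_.Summit.NavierStokesRegularity.NavierStokesRegularity.Theses.ExtremalTypeIConstant.ExtremalSpiralSymmetry →
    ∀ (C : ℝ) (u : ℝ → (EuclideanSpace ℝ (Fin 3)) → (EuclideanSpace ℝ (Fin 3))), 0 < C →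
      (ContDiffOn ℝ (⊤ : ℕ∞) (Function.uncurry u) (Set.Iio 0 ×ˢ Set.univ) ∧
          (∀ t < 0, Literature.Analysis.FluidPDE.VectorCalculus.IsDivFree (u t)) ∧
          (∀ s t : ℝ, s < t → t < 0 → ∀ x, u t x =
            Literature.Analysis.FluidPDE.heatFlow (u s) (t - s) x -
              ∫ τ in Set.Ioo s t, ∫ y,
                Literature.Analysis.FluidPDE.oseenKernel (t - τ) (x - y) (u τ y) (u τ y)) ∧
          Literature.Analysis.FluidPDE.HasTypeITimeDecay C u) ∧
        ‖u (-1) 0‖ = C ∧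
        (∀ (C' : ℝ) (u' : ℝ → (EuclideanSpace ℝ (Fin 3)) → (EuclideanSpace ℝ (Fin 3))),
          (ContDiffOn ℝ (⊤ : ℕ∞) (Function.uncurry u') (Set.Iio 0 ×ˢ Set.univ) ∧
            (∀ t < 0, Literature.Analysis.FluidPDE.VectorCalculus.IsDivFree (u' t)) ∧
            (∀ s t : ℝ, s < t → t < 0 → ∀ x, u' t x =
              Literature.Analysis.FluidPDE.heatFlow (u' s) (t - s) x -
                ∫ τ in Set.Ioo s t, ∫ y,
                  Literature.Analysis.FluidPDE.oseenKernel (t - τ) (x - y) (u' τ y) (u' τ y)) ∧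
            Literature.Analysis.FluidPDE.HasTypeITimeDecay C' u') →
          (∃ t < 0, ∃ x, u' t x ≠ 0) → C ≤ C') →
      ∃ c : ℝ, 0 < c ∧ c ≠ 1 ∧ ∃ (δ : ℝ) (b : (EuclideanSpace ℝ (Fin 3))) (R : (EuclideanSpace ℝ (Fin 3)) ≃ₗᵢ[ℝ] (EuclideanSpace ℝ (Fin 3))), 0 ≤ δ ∧
        ∀ t < 0, ∀ x, c • u (c ^ 2 * t) (c • x) = R (u (t - δ) (R.symm (x - b))) := by
  intro hX C u hC hext
  obtain ⟨a, A, hA, hgen⟩ := hX C u hC hext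
  have hd : DifferentiableOn ℝ (Function.uncurry u) (Set.Iio 0 ×ˢ Set.univ) :=
    hext.1.1.differentiableOn (by simp)
  obtain ⟨xc, hxc⟩ := exists_centre_of_skew A hA a
  -- the generator in normalised rotated form, vertex `(0, x_c)`, `B = A`
  have hgen' : ∀ t < 0, ∀ x, fderiv ℝ (u t) x ((x - xc) + A (x - xc)) + u t x +
      (2 * (t - 0)) • timeDeriv u t x - A (u t x) = 0 := by
    intro t ht x
    have e1 : (x - xc) + A (x - xc) = a + x + A x := by
      have ha : a = -(xc + A xc) := by rw [hxc, neg_neg]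
      rw [map_sub, ha]
      abel
    rw [e1, sub_zero]
    exact hgen t ht x
  -- the rotation `R = e^{A}` as a linear isometry (`L = e^{-A}`, `L.symm = e^{A}`)
  obtain ⟨L, hL1, hL2⟩ := rss_exists_rot (E := (EuclideanSpace ℝ (Fin 3))) hA 1
  refine ⟨Real.exp 1, Real.exp_pos 1, (Real.one_lt_exp_iff.2 one_pos).ne', 0,
    (Real.exp 1)⁻¹ • xc - L.symm xc, L.symm, le_refl 0, fun t ht x => ?_⟩
  rw [sub_zero, LinearIsometryEquiv.symm_symm]
  set y : (EuclideanSpace ℝ (Fin 3)) := L (x - ((Real.exp 1)⁻¹ • xc - L.symm xc)) with hy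
  have h₁ : (0 : ℝ) + Real.exp 0 ^ 2 * t < 0 := by
    rw [zero_add, Real.exp_zero, one_pow, one_mul]; exact ht
  have h₂ : (0 : ℝ) + Real.exp 1 ^ 2 * t < 0 := by
    rw [zero_add]; exact mul_neg_of_pos_of_neg (pow_pos (Real.exp_pos 1) 2) ht
  have key := rss_pull_const (B := A) (θ := 0) (xc := xc) hd hgen' (s := t) y (ρ₁ := 0) (ρ₂ := 1) h₁ h₂
  rw [rss_pull_zero, zero_add, zero_add, ← hL1, ← hL2] at key
  have hy' : xc + Real.exp 1 • L.symm (y - xc) = Real.exp 1 • x := by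
    rw [hy, map_sub, LinearIsometryEquiv.symm_apply_apply, smul_sub, smul_sub, smul_sub, smul_smul,
      mul_inv_cancel₀ (Real.exp_pos 1).ne', one_smul]
    abel
  rw [hy'] at key
  rw [key, map_smul, LinearIsometryEquiv.symm_apply_apply]

/-- **The route target implies the stub (vacuously).** Under `X = TypeIAncientLiouville` (stmt-4050) every
element of `A_C` vanishes on `t < 0`, so no pair with `‖u(−1,0)‖ = C > 0` exists. [folklore] -/
theorem stub_scalingRecurrence_of_TypeIAncientLiouville
    (hX : Theses.ExtremalTypeIConstant.TypeIAncientLiouville) :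
    ∀ (C : ℝ) (u : ℝ → (EuclideanSpace ℝ (Fin 3)) → (EuclideanSpace ℝ (Fin 3))), 0 < C →
      (ContDiffOn ℝ (⊤ : ℕ∞) (Function.uncurry u) (Set.Iio 0 ×ˢ Set.univ) ∧
          (∀ t < 0, Literature.Analysis.FluidPDE.VectorCalculus.IsDivFree (u t)) ∧
          (∀ s t : ℝ, s < t → t < 0 → ∀ x, u t x =
            Literature.Analysis.FluidPDE.heatFlow (u s) (t - s) x -
              ∫ τ in Set.Ioo s t, ∫ y,
                Literature.Analysis.FluidPDE.oseenKernel (t - τ) (x - y) (u τ y) (u τ y)) ∧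
          Literature.Analysis.FluidPDE.HasTypeITimeDecay C u) ∧
        ‖u (-1) 0‖ = C ∧
        (∀ (C' : ℝ) (u' : ℝ → (EuclideanSpace ℝ (Fin 3)) → (EuclideanSpace ℝ (Fin 3))),
          (ContDiffOn ℝ (⊤ : ℕ∞) (Function.uncurry u') (Set.Iio 0 ×ˢ Set.univ) ∧
            (∀ t < 0, Literature.Analysis.FluidPDE.VectorCalculus.IsDivFree (u' t)) ∧
            (∀ s t : ℝ, s < t → t < 0 → ∀ x, u' t x =
              Literature.Analysis.FluidPDE.heatFlow (u' s) (t - s) x -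
                ∫ τ in Set.Ioo s t, ∫ y,
                  Literature.Analysis.FluidPDE.oseenKernel (t - τ) (x - y) (u' τ y) (u' τ y)) ∧
            Literature.Analysis.FluidPDE.HasTypeITimeDecay C' u') →
          (∃ t < 0, ∃ x, u' t x ≠ 0) → C ≤ C') →
      ∃ c : ℝ, 0 < c ∧ c ≠ 1 ∧ ∃ (δ : ℝ) (b : (EuclideanSpace ℝ (Fin 3))) (R : (EuclideanSpace ℝ (Fin 3)) ≃ₗᵢ[ℝ] (EuclideanSpace ℝ (Fin 3))), 0 ≤ δ ∧
        ∀ t < 0, ∀ x, c • u (c ^ 2 * t) (c • x) = R (u (t - δ) (R.symm (x - b))) := by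
  intro C u hC hext
  exfalso
  have h0 : u (-1) 0 = 0 := hX C u hext.1 (-1) (by norm_num) 0
  have h1 := hext.2.1
  rw [h0, norm_zero] at h1
  exact absurd h1.symm hC.ne'

/-- **The sibling crux `ForcedSymmetry` (stmt-4052) implies the stub (vacuously)**, being equivalent in tree
to `X` (`forcedSymmetry_iff_typeIAncientLiouville`, both Killing leaves proved). [folklore] -/
theorem stub_scalingRecurrence_of_ForcedSymmetry
    (hF : Theses.SymmetryModuliCount.ForcedSymmetry) :
    ∀ (C : ℝ) (u : ℝ → (EuclideanSpace ℝ (Fin 3)) → (EuclideanSpace ℝ (Fin 3))), 0 < C →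
      (ContDiffOn ℝ (⊤ : ℕ∞) (Function.uncurry u) (Set.Iio 0 ×ˢ Set.univ) ∧
          (∀ t < 0, Literature.Analysis.FluidPDE.VectorCalculus.IsDivFree (u t)) ∧
          (∀ s t : ℝ, s < t → t < 0 → ∀ x, u t x =
            Literature.Analysis.FluidPDE.heatFlow (u s) (t - s) x -
              ∫ τ in Set.Ioo s t, ∫ y,
                Literature.Analysis.FluidPDE.oseenKernel (t - τ) (x - y) (u τ y) (u τ y)) ∧
          Literature.Analysis.FluidPDE.HasTypeITimeDecay C u) ∧
        ‖u (-1) 0‖ = C ∧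
        (∀ (C' : ℝ) (u' : ℝ → (EuclideanSpace ℝ (Fin 3)) → (EuclideanSpace ℝ (Fin 3))),
          (ContDiffOn ℝ (⊤ : ℕ∞) (Function.uncurry u') (Set.Iio 0 ×ˢ Set.univ) ∧
            (∀ t < 0, Literature.Analysis.FluidPDE.VectorCalculus.IsDivFree (u' t)) ∧
            (∀ s t : ℝ, s < t → t < 0 → ∀ x, u' t x =
              Literature.Analysis.FluidPDE.heatFlow (u' s) (t - s) x -
                ∫ τ in Set.Ioo s t, ∫ y,
                  Literature.Analysis.FluidPDE.oseenKernel (t - τ) (x - y) (u' τ y) (u' τ y)) ∧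
            Literature.Analysis.FluidPDE.HasTypeITimeDecay C' u') →
          (∃ t < 0, ∃ x, u' t x ≠ 0) → C ≤ C') →
      ∃ c : ℝ, 0 < c ∧ c ≠ 1 ∧ ∃ (δ : ℝ) (b : (EuclideanSpace ℝ (Fin 3))) (R : (EuclideanSpace ℝ (Fin 3)) ≃ₗᵢ[ℝ] (EuclideanSpace ℝ (Fin 3))), 0 ≤ δ ∧
        ∀ t < 0, ∀ x, c • u (c ^ 2 * t) (c • x) = R (u (t - δ) (R.symm (x - b))) :=
  stub_scalingRecurrence_of_TypeIAncientLiouville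
    (Theorems.SymmetryModuliCountForcedSymmetry.forcedSymmetry_iff_typeIAncientLiouville.1 hF)

end Summit.NavierStokesRegularity.NavierStokesRegularity.Theorems.ExtremalSpiralSymmetry.Registered

end
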